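import Literature.AlgebraicGeometry.HodgeTheory.QuaternionicQuarticFamilyDeck
import HarnessLib

/-!
# «M1» with clause (iii): the family with deck pair whose fibres are BIRATIONAL to the quartic multiple planes — the
# statement `Q8FamilyDeckBirational`

Layer `Literature/AlgebraicGeometry/HodgeTheory`; STATEMENT file (one definition, no named fact, nothing proved). Written by the
prover seat `hodge-nonav-prover-Bx` (g19, cell `hodge-nonav`), programme M1 (p3 g36 10:40:10Z: «land `Q8FamilyDeck` first with
(o)(i)(ii)(iv)(v)(vi), add (iii) as `Q8FamilyDeck_birational` when M1-1 lands») for route `HodgeConjecture/Q8SymplecticPowers`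
(crux K1Q, stmt-HodgeConjecture-24190; consumed by the transport stub S7 of the skeleton `mechanism-v2`).

`Q8FamilyDeckBirational e` is `Q8FamilyDeck e` (smooth projective family over a non-empty open `W` of the parameter space with
the `W`-automorphisms `τ, j`, `τ⁴ = 1`, `j² = τ²`, `τ j τ = j`, the equivariant open immersion of the explicit étale deck chart,
fibrewise dense) AND clause (iii) of `QFamily e` for the SAME family: the fibre over every complex point `t ∈ W(ℂ)` is birational
over `ℂ` to every hypersurface of `ℙ³_ℂ` cut out by the quartic-multiple-plane form of the coefficient vector of `t`
(Mathlib `Scheme.BirationalOver`). To be discharged as `q8FamilyDeck_birational` from `q8FamilyDeck_holds_away` (base shrunk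
to `D(G_e)`) and the fibrewise chart-in-cover theorem of 19716-p2 (`birationalOver_deckChart_fiberSch`, M1-1).

Honest scope: a statement; nothing is proved here and nothing here bears on HC.

## References

* [Kollar2007] J. Kollár, Lectures on Resolution of Singularities (2007), Thm. 3.36, §3.4.1.
* [EGAIV3] A. Grothendieck, J. Dieudonné, EGA IV₃ (1966), §8.10.5.
-/

noncomputable section

open CategoryTheory CategoryTheory.Limits AlgebraicGeometry MvPolynomial MonoidalCategory CartesianMonoidalCategory
open Literature.AlgebraicGeometry.Motives Literature.AlgebraicGeometry.RelativeSpec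

namespace Literature.AlgebraicGeometry.HodgeTheory.Q8Family

/-- **«Q-FAMILY WITH DECK PAIR AND BIRATIONAL FIBRES»**: the clauses of `Q8FamilyDeck e` together with clause (iii) of
`QFamily e` for the same family — every fibre `𝒳_t`, `t ∈ W(ℂ)`, is birational over `ℂ` to every hypersurface cut out by
`quarticForm e (cOf a(t)) (ψOf a(t))`. NOT proved here (discharge: `q8FamilyDeck_birational`).
[cite: Kollar2007, Thm. 3.36 and §3.4.1] [cite: EGAIV3, §8.10.5] -/
def Q8FamilyDeckBirational (e : ℕ) : Prop :=
  ∃ (W : (Spec (.of (ParamRing e))).Opens) (𝒳 : SchemeOver ℂ) (π : 𝒳 ⟶ base W) (τ j : 𝒳 ⟶ 𝒳)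
    (ι : (deckChart (fun i => (MvPolynomial.X i : ParamRing e)) ⊗ Over.mk W.ι).left ⟶ 𝒳.left),
    Nonempty (ComplexPoints (base W)) ∧ IsSmoothProjectiveFamily π 2 ∧ IsQuasiProjectiveOver 𝒳 ∧
    IsQuasiProjectiveOver (base W) ∧ AlgebraicGeometry.SmoothOfRelativeDimension (Fintype.card (CIdx e)) (base W).hom ∧
    (τ ≫ π = π ∧ j ≫ π = π ∧ τ ≫ τ ≫ τ ≫ τ = 𝟙 𝒳 ∧ j ≫ j = τ ≫ τ ∧ τ ≫ j ≫ τ = j) ∧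
    IsOpenImmersion ι ∧ ι ≫ π.left = (snd (deckChart (fun i => (MvPolynomial.X i : ParamRing e))) (Over.mk W.ι)).left ∧
    ((Over.isoMk ((deckAction (fun i => (MvPolynomial.X i : ParamRing e))).aut (QuaternionGroup.a 1))
        ((deckAction (fun i => (MvPolynomial.X i : ParamRing e))).aut_comp (QuaternionGroup.a 1))).hom ▷
          Over.mk W.ι).left ≫ ι = ι ≫ τ.left ∧
    ((Over.isoMk ((deckAction (fun i => (MvPolynomial.X i : ParamRing e))).aut (QuaternionGroup.xa 0))
        ((deckAction (fun i => (MvPolynomial.X i : ParamRing e))).aut_comp (QuaternionGroup.xa 0))).hom ▷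
          Over.mk W.ι).left ≫ ι = ι ≫ j.left ∧
    Function.Surjective (snd (deckChart (fun i => (MvPolynomial.X i : ParamRing e))) (Over.mk W.ι)).left ∧
    ∀ (t : ComplexPoints (base W)) ⦃V : SchemeOver ℂ⦄,
      IsHypersurfaceCutOutBy 3 (quarticForm e (cOf (coeffs W t)) (ψOf (coeffs W t))) V →
        AlgebraicGeometry.Scheme.BirationalOver (fiberOver π t).hom V.hom

end Literature.AlgebraicGeometry.HodgeTheory.Q8Family

end
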